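import Literature.AlgebraicGeometry.Motives.AbelianVariety
import Literature.AlgebraicGeometry.Motives.CartierDivisor
import Literature.NumberTheory.Kottwitz1992.Involutions
import Mathlib.RingTheory.TensorProduct.Basic
import Mathlib.Analysis.Complex.Basic
import HarnessLib

/-!
# Kottwitz 1992, §9 «ℝ-isogenies, symmetrizations, and polarizations» (pp. 401–402): the `R`-isogeny category,
# `R`-symmetrizations, `R`-polarizations, `B`-abelian varieties up to `R`-isogeny, the Rosati involution, and
# Lemmas 9.1, 9.2 — as a LETTER over one posited datum (the dual abelian variety)

R. E. Kottwitz, *Points on some Shimura varieties over finite fields*, J. Amer. Math. Soc. **5** (1992) 373–444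
[Kottwitz1992], §9, printed pp. 401–402 (held `paper:doi-10-2307-2152772`, pdf pp. 29–30 = p0029–p0030; pdf page =
printed − 372).  Squad TK carpet (cell `hodgecm-mathlib`, seat TK-t04); topic `NumberTheory/Kottwitz1992`, namespace
`Literature.NumberTheory.Kottwitz1992.Polarizations`.  DEFINITIONS WITH BODIES over tree notions + ONE posited datum
(`DualityData`: the dual abelian variety functor over a general field, which the tree lacks as an object) +
`Prop`-valued PREDICATES on that datum for the printed statements (model ★ `Rogawski1990/GlobalPackets`: relations
over a posited datum, nothing asserted); no theorem, no `sorry`, no `axiom`, no instance, no notation.  Dedup: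
`rg 'cite: Kottwitz1992, §9'` = 0 tags; the tree's polarisation currency is SCHEME-level (★
`AbelianSchemes/AbelianSchemeDualPair` = Milne's universal pair `(Â, 𝒫)` as an interface, ★ `AbelianSchemePolarization`
= [MFK] Def. 6.3) and has no `Hom(A, Â) ⊗ R`, no dual homomorphism on `AbelianVariety k`, no biduality — hence the
posit; the dictionary «`DualityData.hat A` IS `D.hat` of a ★ `DualPair` of `ofAbelianVariety A`, `phi Θ` IS the `λ`
with `IsLambdaOfAt … Θ`» is recorded here for a later consolidation edition.

## Source (p. 401, verbatim)

«Let `k` be a field and consider the category of abelian varieties over `k`. For any commutative ring `R` with `1`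
we can also consider the `R`-linear category of abelian varieties up to `R`-isogeny: its objects are abelian varieties
over `k` and the `R`-module of homomorphisms from `A` to `B` is `Hom(A, B) ⊗_ℤ R`, where `Hom(A, B)` is the `ℤ`-module
of `k`-homomorphisms from `A` to `B`. An `R`-isogeny from `A` to `B` is an isomorphism in the category of abelian
varieties up to `R`-isogeny. The functor `A ↦ Â` (`Â` denotes the abelian variety dual to `A`) extends to the category
of abelian varieties up to `R`-isogeny. For any `f ∈ Hom(A, B) ⊗ R` and any `λ ∈ Hom(B, B̂) ⊗ R` we write `f^*(λ)` for
`f̂λf ∈ Hom(A, Â) ⊗ R`.  An `R`-symmetrization of an abelian variety `A` is a symmetric `R`-isogeny `λ : A → Â`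
(symmetric meaning that `λ̂ = λ`). Suppose that `R` is a subring of `ℝ`. An `R`-polarization of `A` is an
`R`-symmetrization `λ : A → Â` that is positive in the following sense: the image of `λ` in `Hom(A, Â) ⊗ ℝ` is a
linear combination with strictly positive coefficients of elements `φ_ℒ ∈ Hom(A, Â)` coming from ample line bundles
`ℒ` on `A` (see [M2] for the definition of `φ_ℒ` …). Let `E` denote the `ℝ`-algebra `End(A) ⊗ ℝ`. Then `E^×` acts on
the right of the `ℝ`-vector space `V` of symmetric elements in `Hom(A, Â) ⊗ ℝ` (… `λ ↦ f^*(λ)`). Looking at §21 of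
[M2] (especially Application III), we see that the set of `ℝ`-polarizations in `V` is a nonempty open convex cone in
`V` and that `E^×` preserves this cone and acts transitively on it.  Let `B` be a semisimple finite-dimensional
`ℚ`-algebra and let `*` be a positive involution on `B`. Let `R` be a `ℚ`-algebra. By a `B`-abelian variety up to
`R`-isogeny we mean an abelian variety `A` up to `R`-isogeny plus a `ℚ`-algebra homomorphism `i : B → End(A)`. …
The dual `Â` to a `B`-abelian variety up to `R`-isogeny is naturally a `B`-abelian variety up to `R`-isogeny, the
homomorphism `B → End(Â)` being given by the composition `B →(*) B →(i) End(A) → End(Â)`. An `R`-symmetrization of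
a `B`-abelian variety `A` up to `R`-isogeny is an `R`-symmetrization of the underlying abelian variety up to
`R`-isogeny that is at the same time a `B`-homomorphism (that is, an element of `Hom_B(A, Â)`). Any
`R`-symmetrization `λ` of the underlying abelian variety `A` determines a Rosati involution `f ↦ ι_λ(f) := λ⁻¹f̂λ` on
`End(A)`, and it is immediate that `λ` is an `R`-symmetrization of the `B`-abelian variety `A` if and only if `i` is
a `*`-homomorphism for `*` on `B` and `ι_λ` on `End(A)`.»  Then **Lemma 9.1** and **Lemma 9.2** (pp. 401–402), quoted
in their docstrings.

## What is typed

* REAL (tree notions): `homR R A B = R ⊗_ℤ Hom(A, B)` for `A B : AbelianVariety k` (★ `Motives.AbelianVariety`, its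
  preadditive Hom groups); the `R`-bilinear composition `mulR` (diagrammatic: `mulR x y = "x then y"`), `oneR`;
  `R`-isogeny = invertible for `mulR`; ample line bundles as ample Cartier divisors (★ `Motives.CartierDivisor`,
  `CartierDivisor.IsAmple`; on an integral scheme every invertible sheaf is `≅ 𝒪(D)`, [GortzWedhorn2020, Cor. 11.30] —
  the convention of ★ `AbelianSchemePolarization`); positive involutions on `B` through ★ `Kottwitz1992.Involutions`
  (`IsInvolution ℚ B ι`, `IsPositiveInvolution (ℝ ⊗_ℚ B) (ι ⊗ ℝ)`).
* POSITED (one datum, `DualityData k`): the dual `A ↦ Â` on objects, `f ↦ f̂` on Hom groups (additive), the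
  biduality isomorphisms `Â̂ ≅ A`, and `ℒ = 𝒪(Θ) ↦ φ_ℒ : A → Â` ([M2] = [MumfordAV1970] §6 Cor. 4 / §8 / §13); its
  standard laws are the separate predicate `DualityData.IsLawful` (not asserted).
* DEFINED over the datum: transpose `λ ↦ λ̂` read on `Hom(A, Â)` via biduality, `IsSymmetric`, `IsRIsogeny`,
  `IsRSymmetrization`, `pullbackAlong` (`f^*(λ) = f̂λf`), `IsPositive` (over `ℝ`), `IsRealPolarization`,
  `IsRatPolarization`, `B`-structures `IsBAction` / `IsBHom` (with the dual `B`-structure `b ↦ (i(b*))^`),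
  `IsRSymmetrizationB`, the Rosati conjugate `rosati`.
* PREDICATES (printed statements): `Kottwitz1992_9_p401_mumford21` (the [M2] §21 sentence), `Kottwitz1992_9_p401_
  symmB_iff_starHom` (the Rosati criterion), `Kottwitz1992_9_1_…` (Lemma 9.1), `Kottwitz1992_9_2_…` (Lemma 9.2).

Specialisation (recorded): the printed `B`-action is a `ℚ`-algebra homomorphism `B → End(A) ⊗ R`; it is typed for
general `R` through `IsBAction R`.  «Open in `W`» for a subset of the finite-dimensional real vector space `W` is
typed RADIALLY («around every point of the set, every direction in `W` stays in the set for small times») — for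
convex sets in finite-dimensional spaces this is openness in `W` ([folklore]); it avoids positing a topology on
`Hom(A, Â) ⊗ ℝ`.  HC_CM is proved only modulo the 7 printed citations until rung 0 closes; nothing here bears on them.

## References
* [Kottwitz1992] §9 pp. 401–402 (Lemma 9.1, 9.2); §2 p. 380 (positive involution), p. 382 (`*`-homomorphism),
  Lemmas 2.8–2.10 pp. 381–382 (used in the proof of 9.1).
* [MumfordAV1970] D. Mumford, *Abelian Varieties* (= Kottwitz's [M2]), §§6, 8, 13 (`φ_ℒ = Λ(ℒ)`), §20–21
  (Rosati involution, Application III p. 208).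
* [GortzWedhorn2020] Cor. 11.30 (invertible sheaves on integral schemes are `𝒪(D)`).
-/

noncomputable section

open CategoryTheory TensorProduct

universe u

namespace Literature.NumberTheory.Kottwitz1992.Polarizations

open Literature.AlgebraicGeometry.Motives Literature.AlgebraicGeometry.Motives.AbelianVariety
open Literature.NumberTheory.Kottwitz1992.Involutions

variable {k : Type u} [Field k]

/-! ## The `R`-isogeny category (p. 401): real carriers -/

/-- The `ℤ`-bilinear composition `Hom(A, B) × Hom(B, C) → Hom(A, C)`, `(f, g) ↦ f ≫ g` (diagrammatic order), of the
preadditive category of abelian varieties over `k` (★ `AbelianVariety.instPreadditive`). [cite: Kottwitz1992, §9 (p. 401)] -/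
def compBil (A B C : AbelianVariety k) : (A ⟶ B) →ₗ[ℤ] (B ⟶ C) →ₗ[ℤ] (A ⟶ C) :=
  LinearMap.mk₂ ℤ (fun f g => f ≫ g) (fun f f' g => Preadditive.add_comp _ _ _ f f' g)
    (fun n f g => Preadditive.zsmul_comp f g n) (fun f g g' => Preadditive.comp_add _ _ _ f g g')
    (fun n f g => Preadditive.comp_zsmul f g n)

section RIsogeny

variable (R : Type) [CommRing R]

/-- **`Hom(A, B) ⊗_ℤ R`**, «the `R`-module of homomorphisms from `A` to `B`» in «the `R`-linear category of abelian
varieties up to `R`-isogeny» (p. 401) (written `R ⊗_ℤ Hom(A, B)` so that Mathlib's left `R`-module structure applies).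
[cite: Kottwitz1992, §9 (p. 401)] -/
abbrev homR (A B : AbelianVariety k) : Type u := R ⊗[ℤ] (A ⟶ B)

/-- Composition in the `R`-isogeny category: `(r ⊗ f, s ⊗ g) ↦ rs ⊗ (f ≫ g)` (diagrammatic order: `mulR x y` is
«`x` then `y`»). [cite: Kottwitz1992, §9 (p. 401)] -/
def mulR {A B C : AbelianVariety k} (x : homR R A B) (y : homR R B C) : homR R A C :=
  TensorProduct.map₂ (LinearMap.mul ℤ R) (compBil A B C) x y

/-- The identity `1 ⊗ 𝟙_A` of `A` in the `R`-isogeny category. [cite: Kottwitz1992, §9 (p. 401)] -/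
def oneR (A : AbelianVariety k) : homR R A A := (1 : R) ⊗ₜ 𝟙 A

/-- **`R`-isogeny** «from `A` to `B` is an isomorphism in the category of abelian varieties up to `R`-isogeny»
(p. 401): `x ∈ Hom(A, B) ⊗ R` with a two-sided inverse. [cite: Kottwitz1992, §9 (p. 401)] -/
def IsRIsogeny {A B : AbelianVariety k} (x : homR R A B) : Prop :=
  ∃ y : homR R B A, mulR R x y = oneR R A ∧ mulR R y x = oneR R B

/-- Change of coefficients `Hom(A, B) ⊗ ℚ → Hom(A, B) ⊗ R` along `ℚ → R` for a `ℚ`-algebra `R` (used with `R = ℝ`: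
«the image of `λ` in `Hom(A, Â) ⊗ ℝ`», p. 401). [cite: Kottwitz1992, §9 (p. 401)] -/
def baseChangeHom [Algebra ℚ R] {A B : AbelianVariety k} : homR ℚ A B →ₗ[ℤ] homR R A B :=
  TensorProduct.map (algebraMap ℚ R).toIntLinearMap LinearMap.id

end RIsogeny

/-! ## The posited datum: the dual abelian variety (p. 401 «the functor `A ↦ Â`»; [M2]) -/

/-- **The duality datum** on abelian varieties over `k` — POSITED (the tree has the dual only as the scheme-level
interface ★ `AbelianSchemes/AbelianSchemeDualPair`, without biduality or `Hom ⊗ R`): `hat A = Â` («the abelian variety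
dual to `A`»), `hatMap f = f̂` on Hom groups (additive, contravariant — «the functor `A ↦ Â` … extends to the category
of abelian varieties up to `R`-isogeny»), the biduality isomorphisms `Â̂ ≅ A` (needed to read «`λ̂ = λ`»), and for an
ample line bundle `ℒ = 𝒪(Θ)` on `A` (an ample Cartier divisor `Θ` on the integral scheme `A`) the homomorphism
`φ_ℒ : A → Â` of [M2] §6/§13.  Its standard laws are `DualityData.IsLawful` (a predicate, not asserted).
[cite: Kottwitz1992, §9 (p. 401)] [cite: MumfordAV1970, §13 (φ_L) and §20 (biduality)] -/
structure DualityData (k : Type u) [Field k] where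
  /-- `A ↦ Â`. -/
  hat : AbelianVariety k → AbelianVariety k
  /-- `f ↦ f̂ : B̂ → Â` for `f : A → B`, additive. -/
  hatMap : ∀ {A B : AbelianVariety k}, (A ⟶ B) →+ (hat B ⟶ hat A)
  /-- Biduality `κ_A : Â̂ ≅ A`. -/
  bidual : ∀ A : AbelianVariety k, hat (hat A) ≅ A
  /-- `φ_{𝒪(Θ)} : A → Â` for a Cartier divisor `Θ` on `A` (used for `Θ` ample). -/
  phi : ∀ {A : AbelianVariety k} [AlgebraicGeometry.IsIntegral A.X.left], CartierDivisor A.X.left → (A ⟶ hat A)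

namespace DualityData

variable (D : DualityData k)

/-- The transpose `λ ↦ λ̂` read back on `Hom(A, Â)` through biduality: `λ ↦ κ_A⁻¹ ≫ λ̂` (`λ̂ : Â̂ → Â`), so that
«symmetric meaning that `λ̂ = λ`» (p. 401) becomes a condition inside `Hom(A, Â)`. [cite: Kottwitz1992, §9 (p. 401)] -/
def transposeHom (A : AbelianVariety k) : (A ⟶ D.hat A) →+ (A ⟶ D.hat A) :=
  (Preadditive.leftComp (D.hat A) (D.bidual A).inv).comp D.hatMap

/-- **Laws of the duality datum** (a predicate; [M2] §§13, 20, 23; not asserted here): `f ↦ f̂` is a contravariant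
additive functor; transposition on `Hom(A, Â)` is an involution; `φ_{𝒪(Θ)}` is symmetric, additive in `Θ`, depends
only on the linear equivalence class of `Θ`, and is an isogeny when `Θ` is ample.
[cite: MumfordAV1970, §13 Thm. 2, §20 Cor. of Thm. 1 (p. 190), §23] [cite: Kottwitz1992, §9 (p. 401)] -/
def IsLawful : Prop :=
  (∀ A : AbelianVariety k, D.hatMap (𝟙 A) = 𝟙 (D.hat A)) ∧
  (∀ {A B C : AbelianVariety k} (f : A ⟶ B) (g : B ⟶ C), D.hatMap (f ≫ g) = D.hatMap g ≫ D.hatMap f) ∧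
  (∀ (A : AbelianVariety k) (f : A ⟶ D.hat A), D.transposeHom A (D.transposeHom A f) = f) ∧
  (∀ (A : AbelianVariety k) [AlgebraicGeometry.IsIntegral A.X.left] (Θ : CartierDivisor A.X.left),
      D.transposeHom A (D.phi Θ) = D.phi Θ) ∧
  (∀ (A : AbelianVariety k) [AlgebraicGeometry.IsIntegral A.X.left] (Θ Θ' : CartierDivisor A.X.left),
      D.phi (Θ.add Θ') = D.phi Θ + D.phi Θ') ∧
  (∀ (A : AbelianVariety k) [AlgebraicGeometry.IsIntegral A.X.left] (Θ Θ' : CartierDivisor A.X.left),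
      Θ.LinEquiv Θ' → D.phi Θ = D.phi Θ') ∧
  (∀ (A : AbelianVariety k) [AlgebraicGeometry.IsIntegral A.X.left] (Θ : CartierDivisor A.X.left),
      Θ.IsAmple → IsIsogeny (D.phi Θ))

section OverR

variable (R : Type) [CommRing R]

/-- `f ↦ f̂` extended `R`-linearly: `Hom(A, B) ⊗ R → Hom(B̂, Â) ⊗ R` (p. 401). [cite: Kottwitz1992, §9 (p. 401)] -/
def hatR {A B : AbelianVariety k} : homR R A B →ₗ[ℤ] homR R (D.hat B) (D.hat A) :=
  TensorProduct.map LinearMap.id D.hatMap.toIntLinearMap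

/-- Transposition `λ ↦ λ̂` on `Hom(A, Â) ⊗ R` (through biduality). [cite: Kottwitz1992, §9 (p. 401)] -/
def transposeR (A : AbelianVariety k) : homR R A (D.hat A) →ₗ[ℤ] homR R A (D.hat A) :=
  TensorProduct.map LinearMap.id (D.transposeHom A).toIntLinearMap

/-- `λ ∈ Hom(A, Â) ⊗ R` is **symmetric**: «`λ̂ = λ`» (p. 401). [cite: Kottwitz1992, §9 (p. 401)] -/
def IsSymmetric {A : AbelianVariety k} (lam : homR R A (D.hat A)) : Prop :=
  D.transposeR R A lam = lam

/-- **`R`-symmetrization** of `A`: «a symmetric `R`-isogeny `λ : A → Â`» (p. 401). [cite: Kottwitz1992, §9 (p. 401)] -/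
def IsRSymmetrization {A : AbelianVariety k} (lam : homR R A (D.hat A)) : Prop :=
  IsRIsogeny R lam ∧ D.IsSymmetric R lam

/-- **`f^*(λ) = f̂ λ f`** for `f ∈ End(A) ⊗ R`, `λ ∈ Hom(A, Â) ⊗ R` (p. 401: «we write `f^*(λ)` for `f̂λf`»; the right
action «`λ ↦ f^*(λ)`» of `E^×`). Diagrammatically `f ≫ λ ≫ f̂`. [cite: Kottwitz1992, §9 (p. 401)] -/
def pullbackAlong {A : AbelianVariety k} (f : homR R A A) (lam : homR R A (D.hat A)) : homR R A (D.hat A) :=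
  mulR R (mulR R f lam) (D.hatR R f)

/-- The **Rosati conjugate** `ι_λ(f) = λ⁻¹ f̂ λ` of `f ∈ End(A) ⊗ R` for an `R`-isogeny `λ` with inverse `μ = λ⁻¹`
(p. 401: «Any `R`-symmetrization `λ` … determines a Rosati involution `f ↦ ι_λ(f) := λ⁻¹f̂λ` on `End(A)`»).
Diagrammatically `λ ≫ f̂ ≫ λ⁻¹`. [cite: Kottwitz1992, §9 (p. 401)] -/
def rosati {A : AbelianVariety k} (lam : homR R A (D.hat A)) (mu : homR R (D.hat A) A) (f : homR R A A) :
    homR R A A :=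
  mulR R (mulR R lam (D.hatR R f)) mu

end OverR

/-! ### Positivity and polarizations (p. 401) -/

/-- **Positivity** of `λ ∈ Hom(A, Â) ⊗ ℝ` (p. 401): «a linear combination with strictly positive coefficients of
elements `φ_ℒ ∈ Hom(A, Â)` coming from ample line bundles `ℒ` on `A`» — ample `ℒ = 𝒪(Θ)`, `Θ` an ample Cartier
divisor on the integral scheme `A` (at least one term). [cite: Kottwitz1992, §9 (p. 401)] -/
def IsPositive {A : AbelianVariety k} [AlgebraicGeometry.IsIntegral A.X.left] (lam : homR ℝ A (D.hat A)) : Prop :=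
  ∃ (n : ℕ) (c : Fin n → ℝ) (Θ : Fin n → CartierDivisor A.X.left), 0 < n ∧ (∀ i, 0 < c i) ∧
    (∀ i, (Θ i).IsAmple) ∧ lam = ∑ i, c i • ((1 : ℝ) ⊗ₜ[ℤ] D.phi (Θ i))

/-- **`ℝ`-polarization** of `A`: an `ℝ`-symmetrization that is positive (p. 401). [cite: Kottwitz1992, §9 (p. 401)] -/
def IsRealPolarization {A : AbelianVariety k} [AlgebraicGeometry.IsIntegral A.X.left] (lam : homR ℝ A (D.hat A)) :
    Prop :=
  D.IsRSymmetrization ℝ lam ∧ D.IsPositive lam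

/-- **`ℚ`-polarization** of `A`: a `ℚ`-symmetrization whose image in `Hom(A, Â) ⊗ ℝ` is positive (p. 401, `R = ℚ ⊆ ℝ`).
[cite: Kottwitz1992, §9 (p. 401)] -/
def IsRatPolarization {A : AbelianVariety k} [AlgebraicGeometry.IsIntegral A.X.left] (lam : homR ℚ A (D.hat A)) :
    Prop :=
  D.IsRSymmetrization ℚ lam ∧ D.IsPositive (baseChangeHom ℝ lam)

/-! ### `B`-abelian varieties up to `R`-isogeny (p. 401) -/

section BStructures

variable (R : Type) [CommRing R] [Algebra ℚ R] {B : Type} [Ring B] [Algebra ℚ B]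

/-- **`B`-abelian variety up to `R`-isogeny** (p. 401: «an abelian variety `A` up to `R`-isogeny plus a `ℚ`-algebra
homomorphism `i : B → End(A)`», `End(A) = End(A) ⊗ R`), the action typed as a `ℚ`-linear map into `End(A) ⊗ R` that
is unital and multiplicative for `mulR`. [cite: Kottwitz1992, §9 (p. 401)] -/
def IsBAction {A : AbelianVariety k} (i : B →ₗ[ℚ] homR R A A) : Prop :=
  i 1 = oneR R A ∧ ∀ b b' : B, i (b * b') = mulR R (i b) (i b')

/-- **`B`-homomorphism `A → Â`** (an element of «`Hom_B(A, Â)`», p. 401), the `B`-structure on `Â` being «the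
composition `B →(*) B →(i) End(A) → End(Â)`», `b ↦ (i(b*))^`: `i(b) ≫ λ = λ ≫ (i(b*))^` for all `b`.
[cite: Kottwitz1992, §9 (p. 401)] -/
def IsBHom (D : DualityData k) {A : AbelianVariety k} (i : B →ₗ[ℚ] homR R A A) (star : B →ₗ[ℚ] B)
    (lam : homR R A (D.hat A)) : Prop :=
  ∀ b : B, mulR R (i b) lam = mulR R lam (D.hatR R (i (star b)))

/-- **`R`-symmetrization of the `B`-abelian variety `A`** (p. 401): an `R`-symmetrization of the underlying abelian
variety that is a `B`-homomorphism. [cite: Kottwitz1992, §9 (p. 401)] -/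
def IsRSymmetrizationB (D : DualityData k) {A : AbelianVariety k} (i : B →ₗ[ℚ] homR R A A) (star : B →ₗ[ℚ] B)
    (lam : homR R A (D.hat A)) : Prop :=
  D.IsRSymmetrization R lam ∧ IsBHom R D i star lam

end BStructures

end DualityData

/-! ## The printed statements, as predicates on the datum -/

open DualityData

/-- **[M2] §21, as quoted on p. 401** (the case `B = ℚ` of Lemma 9.1): «the set of `ℝ`-polarizations in `V` [the
symmetric elements of `Hom(A, Â) ⊗ ℝ`] is a nonempty open convex cone in `V` and … `E^×` [`E = End(A) ⊗ ℝ`] preserves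
this cone and acts transitively on it» — openness typed radially inside `V` (module docstring).
[cite: Kottwitz1992, §9 (p. 401)] [cite: MumfordAV1970, §21 Application III (p. 208)] -/
def Kottwitz1992_9_p401_mumford21 (D : DualityData k) : Prop :=
  ∀ (A : AbelianVariety k) [AlgebraicGeometry.IsIntegral A.X.left],
    (∃ lam : homR ℝ A (D.hat A), D.IsRealPolarization lam) ∧
    (∀ lam : homR ℝ A (D.hat A), D.IsRealPolarization lam → ∀ v : homR ℝ A (D.hat A), D.IsSymmetric ℝ v →
      ∃ ε : ℝ, 0 < ε ∧ ∀ t : ℝ, |t| < ε → D.IsRealPolarization (lam + t • v)) ∧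
    (∀ lam lam' : homR ℝ A (D.hat A), D.IsRealPolarization lam → D.IsRealPolarization lam' →
      ∀ s t : ℝ, 0 < s → 0 < t → D.IsRealPolarization (s • lam + t • lam')) ∧
    (∀ (f : homR ℝ A A) (lam : homR ℝ A (D.hat A)), IsRIsogeny ℝ f → D.IsRealPolarization lam →
      D.IsRealPolarization (D.pullbackAlong ℝ f lam)) ∧
    (∀ lam lam' : homR ℝ A (D.hat A), D.IsRealPolarization lam → D.IsRealPolarization lam' →
      ∃ f : homR ℝ A A, IsRIsogeny ℝ f ∧ D.pullbackAlong ℝ f lam = lam')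

/-- **The Rosati criterion, p. 401** (unnumbered, «it is immediate that»): for an `R`-symmetrization `λ` of the
underlying abelian variety (with inverse `μ`), `λ` is an `R`-symmetrization of the `B`-abelian variety `A` if and
only if `i` is a `*`-homomorphism for `*` on `B` and `ι_λ` on `End(A)`: `i(b*) = λ⁻¹ (i b)^ λ` for all `b`.
[cite: Kottwitz1992, §9 (p. 401)] -/
def Kottwitz1992_9_p401_symmB_iff_starHom (D : DualityData k) : Prop :=
  ∀ (R : Type) [CommRing R] [Algebra ℚ R] (B : Type) [Ring B] [Algebra ℚ B] (star : B →ₗ[ℚ] B),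
    IsInvolution ℚ B star →
    ∀ (A : AbelianVariety k) (i : B →ₗ[ℚ] homR R A A), IsBAction R i →
    ∀ (lam : homR R A (D.hat A)) (mu : homR R (D.hat A) A),
      mulR R lam mu = oneR R A → mulR R mu lam = oneR R (D.hat A) → D.IsSymmetric R lam →
      (IsBHom R D i star lam ↔ ∀ b : B, i (star b) = D.rosati R lam mu (i b))

/-- **[Kottwitz1992, Lemma 9.1 (pp. 401–402)]**, verbatim: «Let `A` be an abelian variety up to `ℝ`-isogeny and let
`W` be the real vector space of symmetric elements (`f̂ = f`) in `Hom_B(A, Â)`. Then the set of `ℝ`-polarizations of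
the `B`-abelian variety `A` is a nonempty open convex cone in `W`. Let `E` be the `ℝ`-algebra `End_B(A)`. Then `E^×`
acts on the right of `W` by the rule `λ ↦ f̂λf` (`λ ∈ W`, `f ∈ E^×`), and this action is transitive.»  Here `B` is a
finite-dimensional semisimple `ℚ`-algebra with positive involution `*` (p. 401; ★ `Involutions.IsPositiveInvolution`
on `B ⊗ ℝ`), `A` carries `i : B → End(A) ⊗ ℝ`; «open» is radial openness inside `W`; «transitive» = on the cone (as in
the [M2] sentence it refines). [cite: Kottwitz1992, Lemma 9.1 (pp. 401–402)] -/
def Kottwitz1992_9_1_realPolarizationsB_cone_transitive (D : DualityData k) : Prop :=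
  ∀ (B : Type) [Ring B] [Algebra ℚ B] (star : B →ₗ[ℚ] B), FiniteDimensional ℚ B → IsSemisimpleRing B →
    IsInvolution ℚ B star → IsPositiveInvolution (ℝ ⊗[ℚ] B) (star.baseChange ℝ) →
    ∀ (A : AbelianVariety k) [AlgebraicGeometry.IsIntegral A.X.left] (i : B →ₗ[ℚ] homR ℝ A A), IsBAction ℝ i →
    -- nonempty
    (∃ lam : homR ℝ A (D.hat A), D.IsRealPolarization lam ∧ IsBHom ℝ D i star lam) ∧
    -- open in W (radially): around a B-compatible ℝ-polarization, every symmetric B-compatible direction stays inside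
    (∀ lam : homR ℝ A (D.hat A), D.IsRealPolarization lam → IsBHom ℝ D i star lam →
      ∀ v : homR ℝ A (D.hat A), D.IsSymmetric ℝ v → IsBHom ℝ D i star v →
      ∃ ε : ℝ, 0 < ε ∧ ∀ t : ℝ, |t| < ε → D.IsRealPolarization (lam + t • v)) ∧
    -- convex cone
    (∀ lam lam' : homR ℝ A (D.hat A), D.IsRealPolarization lam → IsBHom ℝ D i star lam →
      D.IsRealPolarization lam' → IsBHom ℝ D i star lam' →
      ∀ s t : ℝ, 0 < s → 0 < t → D.IsRealPolarization (s • lam + t • lam')) ∧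
    -- E^× = (End_B(A) ⊗ ℝ)^× acts on W ∩ cone by λ ↦ f̂ λ f …
    (∀ (f : homR ℝ A A) (lam : homR ℝ A (D.hat A)), IsRIsogeny ℝ f → (∀ b : B, mulR ℝ (i b) f = mulR ℝ f (i b)) →
      D.IsRealPolarization lam → IsBHom ℝ D i star lam →
      D.IsRealPolarization (D.pullbackAlong ℝ f lam) ∧ IsBHom ℝ D i star (D.pullbackAlong ℝ f lam)) ∧
    -- … transitively
    (∀ lam lam' : homR ℝ A (D.hat A), D.IsRealPolarization lam → IsBHom ℝ D i star lam →
      D.IsRealPolarization lam' → IsBHom ℝ D i star lam' →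
      ∃ f : homR ℝ A A, IsRIsogeny ℝ f ∧ (∀ b : B, mulR ℝ (i b) f = mulR ℝ f (i b)) ∧
        D.pullbackAlong ℝ f lam = lam')

/-- **[Kottwitz1992, Lemma 9.2 (p. 402)]**, verbatim: «Let `A` be an abelian variety up to `ℚ`-isogeny. Then there
exists a `ℚ`-polarization of the `B`-abelian variety `A`.» (`B`, `*` as in Lemma 9.1; `i : B → End(A) ⊗ ℚ`; proof:
the `ℝ`-polarizations form a nonempty open subset of `W_ℝ` by Lemma 9.1 and `W` is dense in `W_ℝ`.)
[cite: Kottwitz1992, Lemma 9.2 (p. 402)] -/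
def Kottwitz1992_9_2_exists_ratPolarizationB (D : DualityData k) : Prop :=
  ∀ (B : Type) [Ring B] [Algebra ℚ B] (star : B →ₗ[ℚ] B), FiniteDimensional ℚ B → IsSemisimpleRing B →
    IsInvolution ℚ B star → IsPositiveInvolution (ℝ ⊗[ℚ] B) (star.baseChange ℝ) →
    ∀ (A : AbelianVariety k) [AlgebraicGeometry.IsIntegral A.X.left] (i : B →ₗ[ℚ] homR ℚ A A), IsBAction ℚ i →
    ∃ lam : homR ℚ A (D.hat A), D.IsRatPolarization lam ∧ IsBHom ℚ D i star lam

end Literature.NumberTheory.Kottwitz1992.Polarizations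

/-! ## ED. 2 (pay-down, proof lane): the laws of the `R`-isogeny category and the discharge of the p. 401 Rosati criterion

Pure proofs appended to the UNCHANGED statements above (Mathlib only; no definition, no new named fact, no `sorry`,
no `axiom`, no `instance`, no `notation`).  Source: [Kottwitz1992] §9 p. 401 = held `paper:doi-10-2307-2152772` p0029
L36–L40: «Any `R`-symmetrization `λ` of the underlying abelian variety `A` determines a Rosati involution
`f ↦ ι_λ(f) := λ⁻¹f̂λ` on `End(A)`, and it is immediate that `λ` is an `R`-symmetrization of the `B`-abelian variety `A` if
and only if `i` is a `*`-homomorphism for `*` on `B` and `ι_λ` on `End(A)`.»  The proof below is the «immediate» one: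
only the category laws of «the `R`-linear category of abelian varieties up to `R`-isogeny» (associativity and units of
`mulR`/`oneR`, p. 401) and `b** = b` are used — neither the laws of the duality datum nor the symmetry of `λ`. -/

namespace Literature.NumberTheory.Kottwitz1992.Polarizations

open Literature.AlgebraicGeometry.Motives Literature.AlgebraicGeometry.Motives.AbelianVariety
open Literature.NumberTheory.Kottwitz1992.Involutions DualityData

section RIsogenyLaws

variable {k : Type u} [Field k] (R : Type) [CommRing R]

/-- Composition of pure tensors in the `R`-isogeny category: `(r ⊗ f)(s ⊗ g) = rs ⊗ (f ≫ g)` (p. 401, «the `R`-linear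
category of abelian varieties up to `R`-isogeny»). [cite: Kottwitz1992, §9 (p. 401)] -/
theorem mulR_tmul {A B C : AbelianVariety k} (r s : R) (f : A ⟶ B) (g : B ⟶ C) :
    mulR R (r ⊗ₜ[ℤ] f) (s ⊗ₜ[ℤ] g) = (r * s) ⊗ₜ[ℤ] (f ≫ g) := rfl

/-- `mulR` is additive in its first argument (the `R`-isogeny category is `R`-linear, p. 401). [cite: Kottwitz1992, §9 (p. 401)] -/
theorem mulR_add_left {A B C : AbelianVariety k} (x x' : homR R A B) (y : homR R B C) :
    mulR R (x + x') y = mulR R x y + mulR R x' y := by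
  simp only [mulR, map_add, LinearMap.add_apply]

/-- `mulR` is additive in its second argument (the `R`-isogeny category is `R`-linear, p. 401). [cite: Kottwitz1992, §9 (p. 401)] -/
theorem mulR_add_right {A B C : AbelianVariety k} (x : homR R A B) (y y' : homR R B C) :
    mulR R x (y + y') = mulR R x y + mulR R x y' := by
  simp only [mulR, map_add]

/-- `0 ∘ y = 0` in the `R`-isogeny category (p. 401). [cite: Kottwitz1992, §9 (p. 401)] -/
theorem mulR_zero_left {A B C : AbelianVariety k} (y : homR R B C) : mulR R (0 : homR R A B) y = 0 := by
  simp only [mulR, map_zero, LinearMap.zero_apply]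

/-- `x ∘ 0 = 0` in the `R`-isogeny category (p. 401). [cite: Kottwitz1992, §9 (p. 401)] -/
theorem mulR_zero_right {A B C : AbelianVariety k} (x : homR R A B) : mulR R x (0 : homR R B C) = 0 := by
  simp only [mulR, map_zero]

/-- **Associativity** of composition in the `R`-isogeny category (p. 401: these form «the `R`-linear category of
abelian varieties up to `R`-isogeny»). [cite: Kottwitz1992, §9 (p. 401)] -/
theorem mulR_assoc {A B C E : AbelianVariety k} (x : homR R A B) (y : homR R B C) (z : homR R C E) :
    mulR R (mulR R x y) z = mulR R x (mulR R y z) := by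
  induction x using TensorProduct.induction_on with
  | zero => simp only [mulR_zero_left]
  | add x x' hx hx' => simp only [mulR_add_left, hx, hx']
  | tmul r f =>
    induction y using TensorProduct.induction_on with
    | zero => simp only [mulR_zero_left, mulR_zero_right]
    | add y y' hy hy' => simp only [mulR_add_left, mulR_add_right, hy, hy']
    | tmul s g =>
      induction z using TensorProduct.induction_on with
      | zero => simp only [mulR_zero_right]
      | add z z' hz hz' => simp only [mulR_add_right, hz, hz']
      | tmul t h => simp only [mulR_tmul, mul_assoc, Category.assoc]

/-- **Right unit**: `x ∘ 𝟙 = x` in the `R`-isogeny category (p. 401). [cite: Kottwitz1992, §9 (p. 401)] -/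
theorem mulR_oneR {A B : AbelianVariety k} (x : homR R A B) : mulR R x (oneR R B) = x := by
  induction x using TensorProduct.induction_on with
  | zero => simp only [mulR_zero_left]
  | add x x' hx hx' => simp only [mulR_add_left, hx, hx']
  | tmul r f => simp only [oneR, mulR_tmul, mul_one, Category.comp_id]

/-- **Left unit**: `𝟙 ∘ x = x` in the `R`-isogeny category (p. 401). [cite: Kottwitz1992, §9 (p. 401)] -/
theorem oneR_mulR {A B : AbelianVariety k} (x : homR R A B) : mulR R (oneR R A) x = x := by
  induction x using TensorProduct.induction_on with
  | zero => simp only [mulR_zero_right]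
  | add x x' hx hx' => simp only [mulR_add_right, hx, hx']
  | tmul r f => simp only [oneR, mulR_tmul, one_mul, Category.id_comp]

end RIsogenyLaws

/-- **Discharge of `Kottwitz1992_9_p401_symmB_iff_starHom`** (the Rosati criterion, p. 401: «it is immediate that `λ` is
an `R`-symmetrization of the `B`-abelian variety `A` if and only if `i` is a `*`-homomorphism for `*` on `B` and `ι_λ`
on `End(A)`»), for EVERY duality datum `D`: (⇒) apply the `B`-compatibility to `b*`, use `b** = b` and multiply by
`λ⁻¹` on the right; (⇐) substitute `i(b) = i(b**) = ι_λ(i(b*))` and cancel `λ⁻¹λ = 1`.  Only the category laws above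
and `IsInvolution.apply_apply` are used. [cite: Kottwitz1992, §9 (p. 401)] -/
theorem Kottwitz1992_9_p401_symmB_iff_starHom_holds :
    ∀ {k : Type u} [Field k] (D : DualityData k), Kottwitz1992_9_p401_symmB_iff_starHom D := by
  intro k _ D R _ _ B _ _ star hstar A i _ lam mu hlm hml _
  constructor
  · intro hB b
    have h := hB (star b)
    rw [hstar.apply_apply] at h
    -- `i(b*) = i(b*) (λ λ⁻¹) = (i(b*) λ) λ⁻¹ = (λ (i b)^) λ⁻¹ = ι_λ(i b)`
    calc i (star b) = mulR R (i (star b)) (mulR R lam mu) := by rw [hlm, mulR_oneR]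
      _ = mulR R (mulR R (i (star b)) lam) mu := by rw [mulR_assoc]
      _ = D.rosati R lam mu (i b) := by rw [h]; rfl
  · intro hR b
    show mulR R (i b) lam = mulR R lam (D.hatR R (i (star b)))
    have h : i b = mulR R (mulR R lam (D.hatR R (i (star b)))) mu := by
      have := hR (star b)
      rwa [hstar.apply_apply] at this
    rw [h, mulR_assoc, hml, mulR_oneR]

end Literature.NumberTheory.Kottwitz1992.Polarizations
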